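import Mathlib
import Summits.NavierStokesRegularity.NavierStokesRegularity.Theorems.SubOnsagerCeilingGapFamily
import Summits.NavierStokesRegularity.NavierStokesRegularity.Theorems.SubOnsagerCeilingVirtualFloorKernelFaceAffine
import HarnessLib

/-!
# Kernel vocabulary and certificate bridge of the PARAMETRIC face family (companion of `SubOnsagerCeilingGapFamily`)
(helper file for crux stmt-NavierStokesRegularity-27057 `SubOnsagerCeiling.ForwardTailCeilingKP`, `--supports … --as helper`;
LEAD SOC g11, line «kp-shell-barrier»)

For a design `θ : Params`: the `ArithExpr` builders `linE`, `quadE`, the coupled field `phiE i`, the damping monomials `dampE i`; the base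
expressions `eBase θ k` / `dBase θ k`, the eliminated coordinate `qElim θ k` (`sElim` as in `GapKernel`), the face expressions at the three
windows and the thirty base slacks `gsBase θ`; the `eval_*` lemmas tying them to `GapFamily.face`/`faceGrad` (so that kernel certificates in the
format of `KernelFaceAffine.leafCheckAff` mean the `hFace` conjuncts of `VirtualFloor.chain_le_of_coupledFaceCertB`); and the bridge
`inertial_of_cert` / `damping_of_cert` / `inertial_real_of_eval`. The LEAD's Python generator (`gen_family.py`, tree
`Cruxes/ForwardTailCeilingKP/Lines/kp_shell_barrier_instruments_g11.md`) builds the identical trees for any `θ`.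
HONEST FRAMING: MODEL-lattice plumbing (route SubOnsagerCeiling, TL-M2Break); nothing here bears on Navier–Stokes regularity; 27057 OPEN.
[cite: FigueiredoStolfi2004, §3] [cite: BarbatoMorandinRomito2011, §2 Lemma 2.1]
-/

noncomputable section

-- the sub-problem namespace `NavierStokesRegularity.NavierStokesRegularity` is the tree's layout (D-0017)
set_option linter.dupNamespace false
-- generated uniform `simp only` lists (one list serves all ten faces)
set_option linter.unusedSimpArgs false

namespace Summit.NavierStokesRegularity.NavierStokesRegularity.Theorems.VirtualFloor.GapFamily

open Literature.Analysis.ValidatedNumerics KernelFaceMul KernelFaceAffine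
open Summit.NavierStokesRegularity.NavierStokesRegularity.Theorems.VirtualFloor
open Summit.NavierStokesRegularity.NavierStokesRegularity.Theorems.VirtualFloor.GapRung (Ix pt pt_mem_box9 allIx sElim)

variable (θ : Params)

/-! ## Builders -/

/-- `c + a·x_i + b·x_j + d·x_k`. [folklore] -/
def linE (c a b d : ℚ) (i j k : ℕ) : ArithExpr :=
  .add (.add (.add (.const c) (.mul (.const a) (.var i))) (.mul (.const b) (.var j))) (.mul (.const d) (.var k))

/-- `q · x_i x_j`. [folklore] -/
def monE (q : ℚ) (i j : ℕ) : ArithExpr := .mul (.const q) (.mul (.var i) (.var j))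

/-- The quadric `c + l·x + Σ q x x` in the slots `i j k`. [folklore] -/
def quadE (c l0 l1 l2 q00 q11 q22 q01 q02 q12 : ℚ) (i j k : ℕ) : ArithExpr :=
  .add (.add (linE c l0 l1 l2 i j k) (.add (.add (monE q00 i i) (monE q11 j j)) (monE q22 k k)))
    (.add (.add (monE q01 i j) (monE q02 i k)) (monE q12 j k))

/-- The coupled field `Φ = (v² − p x₀x₁, L(x₀² − p x₁x₂), L²(x₁² − p x₂x₃), L³(x₂² − p x₃ z))` (slots of `pt`). [folklore] -/
def phiE : Fin 4 → ArithExpr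
  | 0 => .sub (.mul (.var 4) (.var 4)) (.mul (.mul (.var 7) (.var 0)) (.var 1))
  | 1 => .mul (.var 6) (.sub (.mul (.var 0) (.var 0)) (.mul (.mul (.var 7) (.var 1)) (.var 2)))
  | 2 => .mul (.mul (.var 6) (.var 6)) (.sub (.mul (.var 1) (.var 1)) (.mul (.mul (.var 7) (.var 2)) (.var 3)))
  | 3 => .mul (.mul (.var 6) (.mul (.var 6) (.var 6))) (.sub (.mul (.var 2) (.var 2)) (.mul (.mul (.var 7) (.var 3)) (.var 5)))

/-- The damping monomials `b2ⁱ x_i`. [folklore] -/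
def dampE : Fin 4 → ArithExpr
  | 0 => .var 0
  | 1 => .mul (.var 8) (.var 1)
  | 2 => .mul (.mul (.var 8) (.var 8)) (.var 2)
  | 3 => .mul (.mul (.var 8) (.mul (.var 8) (.var 8))) (.var 3)

/-- Cubic-floor gradient factor `3κ x_i²`. [folklore] -/
def cubGE (κ : ℚ) (i : ℕ) : ArithExpr := .mul (.const (3 * κ)) (.mul (.var i) (.var i))

/-- Gradient of a quadric floor in the window slots `0,1,2` (the three linear forms). [folklore] -/
def gradE (l0 l1 l2 q00 q11 q22 q01 q02 q12 : ℚ) : Fin 3 → ArithExpr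
  | 0 => linE l0 (2 * q00) q01 q02 0 1 2
  | 1 => linE l1 q01 (2 * q11) q12 0 1 2
  | 2 => linE l2 q02 q12 (2 * q22) 0 1 2

/-- Contraction `d0·W0 + d1·W1 + d2·W2 − W3` of a floor gradient with a 4-vector of expressions. [folklore] -/
def floorForm (d : Fin 3 → ArithExpr) (W : Fin 4 → ArithExpr) : ArithExpr :=
  .sub (.add (.add (.mul (d 0) (W 0)) (.mul (d 1) (W 1))) (.mul (d 2) (W 2))) (W 3)

/-- Generic base form of face `k` against a 4-vector of expressions `W` (`W = phiE`: inertial; `W = dampE`: damping). [folklore] -/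
def baseForm (W : Fin 4 → ArithExpr) : Ix → ArithExpr
  | .cap1 => W 1
  | .cap2 => W 2
  | .cap3 => W 3
  | .cub0 => .sub (.mul (cubGE θ.kap 0) (W 0)) (W 1)
  | .cub1 => .sub (.mul (cubGE θ.kap 1) (W 1)) (W 2)
  | .cub2 => .sub (.mul (cubGE θ.kap 2) (W 2)) (W 3)
  | .capA => .add (.add (.mul (.const θ.a0) (W 0)) (.mul (.const θ.a1) (W 1))) (.mul (.const θ.a2) (W 2))
  | .capB => .add (W 0) (.mul (.const θ.b1) (W 1))
  | .bulk => floorForm (gradE θ.f0 θ.f1 θ.f2 θ.f00 θ.f11 θ.f22 θ.f01 θ.f02 θ.f12) W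
  | .carve => floorForm (gradE θ.g0 θ.g1 θ.g2 θ.g00 θ.g11 θ.g22 θ.g01 θ.g02 θ.g12) W

/-- The INERTIAL base expression of face `k`. [folklore] -/
def eBase (k : Ix) : ArithExpr := baseForm θ phiE k

/-- The DAMPING base expression of face `k`. [folklore] -/
def dBase (k : Ix) : ArithExpr := baseForm θ dampE k

/-- The eliminated coordinate on the active face `k` as an expression of the others. [folklore] -/
def qElim : Ix → ArithExpr
  | .cap1 => .const (49 / 50)
  | .cap2 => .const (49 / 50)
  | .cap3 => .const (49 / 50)
  | .cub0 => .sub (.mul (.const θ.kap) (.mul (.var 0) (.mul (.var 0) (.var 0)))) (.const θ.eps)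
  | .cub1 => .sub (.mul (.const θ.kap) (.mul (.var 1) (.mul (.var 1) (.var 1)))) (.const θ.eps)
  | .cub2 => .sub (.mul (.const θ.kap) (.mul (.var 2) (.mul (.var 2) (.var 2)))) (.const θ.eps)
  | .capA => linE (θ.ac / θ.a0) 0 (-(θ.a1 / θ.a0)) (-(θ.a2 / θ.a0)) 0 1 2
  | .capB => linE θ.bc 0 (-θ.b1) 0 0 1 2
  | .bulk => quadE θ.fc θ.f0 θ.f1 θ.f2 θ.f00 θ.f11 θ.f22 θ.f01 θ.f02 θ.f12 0 1 2
  | .carve => quadE θ.gc θ.g0 θ.g1 θ.g2 θ.g00 θ.g11 θ.g22 θ.g01 θ.g02 θ.g12 0 1 2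

/-- The face `k` as an expression at a window occupying the slots `s` (window `x`: `(0,1,2,3)`; below: `(4,0,1,2)`; above:
`(1,2,3,5)`). [folklore] -/
def faceE (s : Fin 4 → ℕ) : Ix → ArithExpr
  | .cap1 => .sub (.var (s 1)) (.const (49 / 50))
  | .cap2 => .sub (.var (s 2)) (.const (49 / 50))
  | .cap3 => .sub (.var (s 3)) (.const (49 / 50))
  | .cub0 => .sub (.sub (.mul (.const θ.kap) (.mul (.var (s 0)) (.mul (.var (s 0)) (.var (s 0))))) (.const θ.eps)) (.var (s 1))
  | .cub1 => .sub (.sub (.mul (.const θ.kap) (.mul (.var (s 1)) (.mul (.var (s 1)) (.var (s 1))))) (.const θ.eps)) (.var (s 2))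
  | .cub2 => .sub (.sub (.mul (.const θ.kap) (.mul (.var (s 2)) (.mul (.var (s 2)) (.var (s 2))))) (.const θ.eps)) (.var (s 3))
  | .capA => linE (-θ.ac) θ.a0 θ.a1 θ.a2 (s 0) (s 1) (s 2)
  | .capB => linE (-θ.bc) 1 θ.b1 0 (s 0) (s 1) (s 2)
  | .bulk => .sub (quadE θ.fc θ.f0 θ.f1 θ.f2 θ.f00 θ.f11 θ.f22 θ.f01 θ.f02 θ.f12 (s 0) (s 1) (s 2)) (.var (s 3))
  | .carve => .sub (quadE θ.gc θ.g0 θ.g1 θ.g2 θ.g00 θ.g11 θ.g22 θ.g01 θ.g02 θ.g12 (s 0) (s 1) (s 2)) (.var (s 3))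

/-- Slots of the window itself. [folklore] -/
def slotsX : Fin 4 → ℕ | 0 => 0 | 1 => 1 | 2 => 2 | 3 => 3
/-- Slots of the window below `(v, x₀, x₁, x₂)`. [folklore] -/
def slotsLo : Fin 4 → ℕ | 0 => 4 | 1 => 0 | 2 => 1 | 3 => 2
/-- Slots of the window above `(x₁, x₂, x₃, z)`. [folklore] -/
def slotsUp : Fin 4 → ℕ | 0 => 1 | 1 => 2 | 2 => 3 | 3 => 5

/-- The thirty BASE SLACKS (`−face` at the window, the window below, the window above; canonical order). [folklore] -/
def gsBase : List ArithExpr :=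
  allIx.map (fun j => .neg (faceE θ slotsX j)) ++ allIx.map (fun j => .neg (faceE θ slotsLo j)) ++
    allIx.map (fun j => .neg (faceE θ slotsUp j))

/-! ## Evaluation lemmas -/

section evals
variable (x : Fin 4 → ℝ) (v z L p b2 : ℝ)

/-- The field expressions evaluate to the coupled field. [folklore] -/
theorem eval_phiE :
    (phiE 0).eval (pt x v z L p b2) = v ^ 2 - p * x 0 * x 1 ∧ (phiE 1).eval (pt x v z L p b2) = L * (x 0 ^ 2 - p * x 1 * x 2) ∧
    (phiE 2).eval (pt x v z L p b2) = L ^ 2 * (x 1 ^ 2 - p * x 2 * x 3) ∧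
    (phiE 3).eval (pt x v z L p b2) = L ^ 3 * (x 2 ^ 2 - p * x 3 * z) := by
  refine ⟨?_, ?_, ?_, ?_⟩ <;> simp only [phiE, ArithExpr.eval_add, ArithExpr.eval_sub, ArithExpr.eval_mul, ArithExpr.eval_neg, ArithExpr.eval_const, ArithExpr.eval_var, GapRung.pt_0, GapRung.pt_1, GapRung.pt_2, GapRung.pt_3, GapRung.pt_4, GapRung.pt_5, GapRung.pt_6, GapRung.pt_7, GapRung.pt_8] <;> ring

/-- The damping monomials evaluate to `b2ⁱ xᵢ`. [folklore] -/
theorem eval_dampE :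
    (dampE 0).eval (pt x v z L p b2) = x 0 ∧ (dampE 1).eval (pt x v z L p b2) = b2 * x 1 ∧
    (dampE 2).eval (pt x v z L p b2) = b2 ^ 2 * x 2 ∧ (dampE 3).eval (pt x v z L p b2) = b2 ^ 3 * x 3 := by
  refine ⟨?_, ?_, ?_, ?_⟩ <;> simp only [dampE, ArithExpr.eval_add, ArithExpr.eval_sub, ArithExpr.eval_mul, ArithExpr.eval_neg, ArithExpr.eval_const, ArithExpr.eval_var, GapRung.pt_0, GapRung.pt_1, GapRung.pt_2, GapRung.pt_3, GapRung.pt_4, GapRung.pt_5, GapRung.pt_6, GapRung.pt_7, GapRung.pt_8] <;> ring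

/-- **The generic base form evaluates to the gradient contraction.** [folklore] -/
theorem eval_baseForm (W : Fin 4 → ArithExpr) (w : Fin 4 → ℝ) (hW : ∀ i, (W i).eval (pt x v z L p b2) = w i) (k : Ix) :
    (baseForm θ W k).eval (pt x v z L p b2) =
      faceGrad θ k 0 x * w 0 + faceGrad θ k 1 x * w 1 + faceGrad θ k 2 x * w 2 + faceGrad θ k 3 x * w 3 := by
  obtain ⟨g1, g2, g3, g4, g5, g6, g7, g8, g9, g10⟩ := faceGrad_eq θ x
  have h0 := hW 0; have h1 := hW 1; have h2 := hW 2; have h3 := hW 3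
  cases k
  · rw [g1.1, g1.2.1, g1.2.2.1, g1.2.2.2]; simp only [baseForm, floorForm, gradE, linE, cubGE, h0, h1, h2, h3, ArithExpr.eval_add, ArithExpr.eval_sub, ArithExpr.eval_mul, ArithExpr.eval_neg, ArithExpr.eval_const, ArithExpr.eval_var, GapRung.pt_0, GapRung.pt_1, GapRung.pt_2, GapRung.pt_3, GapRung.pt_4, GapRung.pt_5, GapRung.pt_6, GapRung.pt_7, GapRung.pt_8, Rat.cast_mul, Rat.cast_add, Rat.cast_sub, Rat.cast_neg, Rat.cast_div, Rat.cast_ofNat, Rat.cast_one, Rat.cast_zero]; ring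
  · rw [g2.1, g2.2.1, g2.2.2.1, g2.2.2.2]; simp only [baseForm, floorForm, gradE, linE, cubGE, h0, h1, h2, h3, ArithExpr.eval_add, ArithExpr.eval_sub, ArithExpr.eval_mul, ArithExpr.eval_neg, ArithExpr.eval_const, ArithExpr.eval_var, GapRung.pt_0, GapRung.pt_1, GapRung.pt_2, GapRung.pt_3, GapRung.pt_4, GapRung.pt_5, GapRung.pt_6, GapRung.pt_7, GapRung.pt_8, Rat.cast_mul, Rat.cast_add, Rat.cast_sub, Rat.cast_neg, Rat.cast_div, Rat.cast_ofNat, Rat.cast_one, Rat.cast_zero]; ring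
  · rw [g3.1, g3.2.1, g3.2.2.1, g3.2.2.2]; simp only [baseForm, floorForm, gradE, linE, cubGE, h0, h1, h2, h3, ArithExpr.eval_add, ArithExpr.eval_sub, ArithExpr.eval_mul, ArithExpr.eval_neg, ArithExpr.eval_const, ArithExpr.eval_var, GapRung.pt_0, GapRung.pt_1, GapRung.pt_2, GapRung.pt_3, GapRung.pt_4, GapRung.pt_5, GapRung.pt_6, GapRung.pt_7, GapRung.pt_8, Rat.cast_mul, Rat.cast_add, Rat.cast_sub, Rat.cast_neg, Rat.cast_div, Rat.cast_ofNat, Rat.cast_one, Rat.cast_zero]; ring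
  · rw [g4.1, g4.2.1, g4.2.2.1, g4.2.2.2]; simp only [baseForm, floorForm, gradE, linE, cubGE, h0, h1, h2, h3, ArithExpr.eval_add, ArithExpr.eval_sub, ArithExpr.eval_mul, ArithExpr.eval_neg, ArithExpr.eval_const, ArithExpr.eval_var, GapRung.pt_0, GapRung.pt_1, GapRung.pt_2, GapRung.pt_3, GapRung.pt_4, GapRung.pt_5, GapRung.pt_6, GapRung.pt_7, GapRung.pt_8, Rat.cast_mul, Rat.cast_add, Rat.cast_sub, Rat.cast_neg, Rat.cast_div, Rat.cast_ofNat, Rat.cast_one, Rat.cast_zero]; ring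
  · rw [g5.1, g5.2.1, g5.2.2.1, g5.2.2.2]; simp only [baseForm, floorForm, gradE, linE, cubGE, h0, h1, h2, h3, ArithExpr.eval_add, ArithExpr.eval_sub, ArithExpr.eval_mul, ArithExpr.eval_neg, ArithExpr.eval_const, ArithExpr.eval_var, GapRung.pt_0, GapRung.pt_1, GapRung.pt_2, GapRung.pt_3, GapRung.pt_4, GapRung.pt_5, GapRung.pt_6, GapRung.pt_7, GapRung.pt_8, Rat.cast_mul, Rat.cast_add, Rat.cast_sub, Rat.cast_neg, Rat.cast_div, Rat.cast_ofNat, Rat.cast_one, Rat.cast_zero]; ring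
  · rw [g6.1, g6.2.1, g6.2.2.1, g6.2.2.2]; simp only [baseForm, floorForm, gradE, linE, cubGE, h0, h1, h2, h3, ArithExpr.eval_add, ArithExpr.eval_sub, ArithExpr.eval_mul, ArithExpr.eval_neg, ArithExpr.eval_const, ArithExpr.eval_var, GapRung.pt_0, GapRung.pt_1, GapRung.pt_2, GapRung.pt_3, GapRung.pt_4, GapRung.pt_5, GapRung.pt_6, GapRung.pt_7, GapRung.pt_8, Rat.cast_mul, Rat.cast_add, Rat.cast_sub, Rat.cast_neg, Rat.cast_div, Rat.cast_ofNat, Rat.cast_one, Rat.cast_zero]; ring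
  · rw [g7.1, g7.2.1, g7.2.2.1, g7.2.2.2]; simp only [baseForm, floorForm, gradE, linE, cubGE, h0, h1, h2, h3, ArithExpr.eval_add, ArithExpr.eval_sub, ArithExpr.eval_mul, ArithExpr.eval_neg, ArithExpr.eval_const, ArithExpr.eval_var, GapRung.pt_0, GapRung.pt_1, GapRung.pt_2, GapRung.pt_3, GapRung.pt_4, GapRung.pt_5, GapRung.pt_6, GapRung.pt_7, GapRung.pt_8, Rat.cast_mul, Rat.cast_add, Rat.cast_sub, Rat.cast_neg, Rat.cast_div, Rat.cast_ofNat, Rat.cast_one, Rat.cast_zero]; ring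
  · rw [g8.1, g8.2.1, g8.2.2.1, g8.2.2.2]; simp only [baseForm, floorForm, gradE, linE, cubGE, h0, h1, h2, h3, ArithExpr.eval_add, ArithExpr.eval_sub, ArithExpr.eval_mul, ArithExpr.eval_neg, ArithExpr.eval_const, ArithExpr.eval_var, GapRung.pt_0, GapRung.pt_1, GapRung.pt_2, GapRung.pt_3, GapRung.pt_4, GapRung.pt_5, GapRung.pt_6, GapRung.pt_7, GapRung.pt_8, Rat.cast_mul, Rat.cast_add, Rat.cast_sub, Rat.cast_neg, Rat.cast_div, Rat.cast_ofNat, Rat.cast_one, Rat.cast_zero]; ring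
  · rw [g9.1, g9.2.1, g9.2.2.1, g9.2.2.2]; simp only [baseForm, floorForm, gradE, linE, cubGE, h0, h1, h2, h3, ArithExpr.eval_add, ArithExpr.eval_sub, ArithExpr.eval_mul, ArithExpr.eval_neg, ArithExpr.eval_const, ArithExpr.eval_var, GapRung.pt_0, GapRung.pt_1, GapRung.pt_2, GapRung.pt_3, GapRung.pt_4, GapRung.pt_5, GapRung.pt_6, GapRung.pt_7, GapRung.pt_8, Rat.cast_mul, Rat.cast_add, Rat.cast_sub, Rat.cast_neg, Rat.cast_div, Rat.cast_ofNat, Rat.cast_one, Rat.cast_zero]; ring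
  · rw [g10.1, g10.2.1, g10.2.2.1, g10.2.2.2]; simp only [baseForm, floorForm, gradE, linE, cubGE, h0, h1, h2, h3, ArithExpr.eval_add, ArithExpr.eval_sub, ArithExpr.eval_mul, ArithExpr.eval_neg, ArithExpr.eval_const, ArithExpr.eval_var, GapRung.pt_0, GapRung.pt_1, GapRung.pt_2, GapRung.pt_3, GapRung.pt_4, GapRung.pt_5, GapRung.pt_6, GapRung.pt_7, GapRung.pt_8, Rat.cast_mul, Rat.cast_add, Rat.cast_sub, Rat.cast_neg, Rat.cast_div, Rat.cast_ofNat, Rat.cast_one, Rat.cast_zero]; ring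

/-- **The inertial base expression evaluates to the inertial form of the `hFace` hypothesis.** [folklore] -/
theorem eval_eBase (k : Ix) : (eBase θ k).eval (pt x v z L p b2) =
    faceGrad θ k 0 x * (v ^ 2 - p * x 0 * x 1) + faceGrad θ k 1 x * (L * (x 0 ^ 2 - p * x 1 * x 2)) +
      faceGrad θ k 2 x * (L ^ 2 * (x 1 ^ 2 - p * x 2 * x 3)) + faceGrad θ k 3 x * (L ^ 3 * (x 2 ^ 2 - p * x 3 * z)) := by
  obtain ⟨h0, h1, h2, h3⟩ := eval_phiE x v z L p b2
  exact eval_baseForm θ x v z L p b2 phiE ![v ^ 2 - p * x 0 * x 1, L * (x 0 ^ 2 - p * x 1 * x 2),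
    L ^ 2 * (x 1 ^ 2 - p * x 2 * x 3), L ^ 3 * (x 2 ^ 2 - p * x 3 * z)]
    (fun i => by fin_cases i <;> simp [h0, h1, h2, h3]) k

/-- **The damping base expression evaluates to the damping form of the `hFace` hypothesis.** [folklore] -/
theorem eval_dBase (k : Ix) : (dBase θ k).eval (pt x v z L p b2) =
    faceGrad θ k 0 x * x 0 + faceGrad θ k 1 x * (b2 * x 1) + faceGrad θ k 2 x * (b2 ^ 2 * x 2) +
      faceGrad θ k 3 x * (b2 ^ 3 * x 3) := by
  obtain ⟨h0, h1, h2, h3⟩ := eval_dampE x v z L p b2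
  exact eval_baseForm θ x v z L p b2 dampE ![x 0, b2 * x 1, b2 ^ 2 * x 2, b2 ^ 3 * x 3]
    (fun i => by fin_cases i <;> simp [h0, h1, h2, h3]) k

/-- **On the active face the eliminated slot of the point equals the value of `qElim`** (`a0 ≠ 0` for the corner cap A). [folklore] -/
theorem pt_sElim_eq (ha0 : θ.a0 ≠ 0) (k : Ix) (hk : face θ k x = 0) :
    pt x v z L p b2 (sElim k) = (qElim θ k).eval (pt x v z L p b2) := by
  obtain ⟨e1, e2, e3, e4, e5, e6, e7, e8, e9, e10⟩ := face_eq θ x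
  have ha : (θ.a0 : ℝ) ≠ 0 := by exact_mod_cast ha0
  cases k
  · rw [e1] at hk; simp only [sElim, qElim, linE, quadE, monE, ArithExpr.eval_add, ArithExpr.eval_sub, ArithExpr.eval_mul, ArithExpr.eval_neg, ArithExpr.eval_const, ArithExpr.eval_var, GapRung.pt_0, GapRung.pt_1, GapRung.pt_2, GapRung.pt_3, GapRung.pt_4, GapRung.pt_5, GapRung.pt_6, GapRung.pt_7, GapRung.pt_8, Rat.cast_mul, Rat.cast_add, Rat.cast_sub, Rat.cast_neg, Rat.cast_div, Rat.cast_ofNat, Rat.cast_one, Rat.cast_zero]; linarith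
  · rw [e2] at hk; simp only [sElim, qElim, linE, quadE, monE, ArithExpr.eval_add, ArithExpr.eval_sub, ArithExpr.eval_mul, ArithExpr.eval_neg, ArithExpr.eval_const, ArithExpr.eval_var, GapRung.pt_0, GapRung.pt_1, GapRung.pt_2, GapRung.pt_3, GapRung.pt_4, GapRung.pt_5, GapRung.pt_6, GapRung.pt_7, GapRung.pt_8, Rat.cast_mul, Rat.cast_add, Rat.cast_sub, Rat.cast_neg, Rat.cast_div, Rat.cast_ofNat, Rat.cast_one, Rat.cast_zero]; linarith
  · rw [e3] at hk; simp only [sElim, qElim, linE, quadE, monE, ArithExpr.eval_add, ArithExpr.eval_sub, ArithExpr.eval_mul, ArithExpr.eval_neg, ArithExpr.eval_const, ArithExpr.eval_var, GapRung.pt_0, GapRung.pt_1, GapRung.pt_2, GapRung.pt_3, GapRung.pt_4, GapRung.pt_5, GapRung.pt_6, GapRung.pt_7, GapRung.pt_8, Rat.cast_mul, Rat.cast_add, Rat.cast_sub, Rat.cast_neg, Rat.cast_div, Rat.cast_ofNat, Rat.cast_one, Rat.cast_zero]; linarith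
  · rw [e4] at hk; simp only [sElim, qElim, linE, quadE, monE, ArithExpr.eval_add, ArithExpr.eval_sub, ArithExpr.eval_mul, ArithExpr.eval_neg, ArithExpr.eval_const, ArithExpr.eval_var, GapRung.pt_0, GapRung.pt_1, GapRung.pt_2, GapRung.pt_3, GapRung.pt_4, GapRung.pt_5, GapRung.pt_6, GapRung.pt_7, GapRung.pt_8, Rat.cast_mul, Rat.cast_add, Rat.cast_sub, Rat.cast_neg, Rat.cast_div, Rat.cast_ofNat, Rat.cast_one, Rat.cast_zero]; linarith
  · rw [e5] at hk; simp only [sElim, qElim, linE, quadE, monE, ArithExpr.eval_add, ArithExpr.eval_sub, ArithExpr.eval_mul, ArithExpr.eval_neg, ArithExpr.eval_const, ArithExpr.eval_var, GapRung.pt_0, GapRung.pt_1, GapRung.pt_2, GapRung.pt_3, GapRung.pt_4, GapRung.pt_5, GapRung.pt_6, GapRung.pt_7, GapRung.pt_8, Rat.cast_mul, Rat.cast_add, Rat.cast_sub, Rat.cast_neg, Rat.cast_div, Rat.cast_ofNat, Rat.cast_one, Rat.cast_zero]; linarith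
  · rw [e6] at hk; simp only [sElim, qElim, linE, quadE, monE, ArithExpr.eval_add, ArithExpr.eval_sub, ArithExpr.eval_mul, ArithExpr.eval_neg, ArithExpr.eval_const, ArithExpr.eval_var, GapRung.pt_0, GapRung.pt_1, GapRung.pt_2, GapRung.pt_3, GapRung.pt_4, GapRung.pt_5, GapRung.pt_6, GapRung.pt_7, GapRung.pt_8, Rat.cast_mul, Rat.cast_add, Rat.cast_sub, Rat.cast_neg, Rat.cast_div, Rat.cast_ofNat, Rat.cast_one, Rat.cast_zero]; linarith
  · rw [e7] at hk; simp only [sElim, qElim, linE, quadE, monE, ArithExpr.eval_add, ArithExpr.eval_sub, ArithExpr.eval_mul, ArithExpr.eval_neg, ArithExpr.eval_const, ArithExpr.eval_var, GapRung.pt_0, GapRung.pt_1, GapRung.pt_2, GapRung.pt_3, GapRung.pt_4, GapRung.pt_5, GapRung.pt_6, GapRung.pt_7, GapRung.pt_8, Rat.cast_mul, Rat.cast_add, Rat.cast_sub, Rat.cast_neg, Rat.cast_div, Rat.cast_ofNat, Rat.cast_one, Rat.cast_zero]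
    have hx0 : x 0 = ((θ.ac : ℝ) - θ.a1 * x 1 - θ.a2 * x 2) / θ.a0 := by rw [eq_div_iff ha]; linarith
    rw [hx0]; ring
  · rw [e8] at hk; simp only [sElim, qElim, linE, quadE, monE, ArithExpr.eval_add, ArithExpr.eval_sub, ArithExpr.eval_mul, ArithExpr.eval_neg, ArithExpr.eval_const, ArithExpr.eval_var, GapRung.pt_0, GapRung.pt_1, GapRung.pt_2, GapRung.pt_3, GapRung.pt_4, GapRung.pt_5, GapRung.pt_6, GapRung.pt_7, GapRung.pt_8, Rat.cast_mul, Rat.cast_add, Rat.cast_sub, Rat.cast_neg, Rat.cast_div, Rat.cast_ofNat, Rat.cast_one, Rat.cast_zero]; linarith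
  · rw [e9] at hk; simp only [sElim, qElim, linE, quadE, monE, ArithExpr.eval_add, ArithExpr.eval_sub, ArithExpr.eval_mul, ArithExpr.eval_neg, ArithExpr.eval_const, ArithExpr.eval_var, GapRung.pt_0, GapRung.pt_1, GapRung.pt_2, GapRung.pt_3, GapRung.pt_4, GapRung.pt_5, GapRung.pt_6, GapRung.pt_7, GapRung.pt_8, Rat.cast_mul, Rat.cast_add, Rat.cast_sub, Rat.cast_neg, Rat.cast_div, Rat.cast_ofNat, Rat.cast_one, Rat.cast_zero]; linarith
  · rw [e10] at hk; simp only [sElim, qElim, linE, quadE, monE, ArithExpr.eval_add, ArithExpr.eval_sub, ArithExpr.eval_mul, ArithExpr.eval_neg, ArithExpr.eval_const, ArithExpr.eval_var, GapRung.pt_0, GapRung.pt_1, GapRung.pt_2, GapRung.pt_3, GapRung.pt_4, GapRung.pt_5, GapRung.pt_6, GapRung.pt_7, GapRung.pt_8, Rat.cast_mul, Rat.cast_add, Rat.cast_sub, Rat.cast_neg, Rat.cast_div, Rat.cast_ofNat, Rat.cast_one, Rat.cast_zero]; linarith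

/-- The face expression at the slots `s` evaluates to the face at the window read off those slots. [folklore] -/
theorem eval_faceE (y : ℕ → ℝ) (s : Fin 4 → ℕ) (j : Ix) :
    (faceE θ s j).eval y = face θ j (vec4 (y (s 0)) (y (s 1)) (y (s 2)) (y (s 3))) := by
  have e := face_eq θ (vec4 (y (s 0)) (y (s 1)) (y (s 2)) (y (s 3)))
  simp only [vec4_zero, vec4_one, vec4_two, vec4_three] at e
  obtain ⟨a1, a2, a3, a4, a5, a6, a7, a8, a9, a10⟩ := e
  cases j
  · rw [a1]; simp only [faceE, linE, quadE, monE, ArithExpr.eval_add, ArithExpr.eval_sub, ArithExpr.eval_mul, ArithExpr.eval_neg, ArithExpr.eval_const, ArithExpr.eval_var, Rat.cast_mul, Rat.cast_add, Rat.cast_sub, Rat.cast_neg, Rat.cast_div, Rat.cast_ofNat, Rat.cast_one, Rat.cast_zero]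
  · rw [a2]; simp only [faceE, linE, quadE, monE, ArithExpr.eval_add, ArithExpr.eval_sub, ArithExpr.eval_mul, ArithExpr.eval_neg, ArithExpr.eval_const, ArithExpr.eval_var, Rat.cast_mul, Rat.cast_add, Rat.cast_sub, Rat.cast_neg, Rat.cast_div, Rat.cast_ofNat, Rat.cast_one, Rat.cast_zero]
  · rw [a3]; simp only [faceE, linE, quadE, monE, ArithExpr.eval_add, ArithExpr.eval_sub, ArithExpr.eval_mul, ArithExpr.eval_neg, ArithExpr.eval_const, ArithExpr.eval_var, Rat.cast_mul, Rat.cast_add, Rat.cast_sub, Rat.cast_neg, Rat.cast_div, Rat.cast_ofNat, Rat.cast_one, Rat.cast_zero]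
  · rw [a4]; simp only [faceE, linE, quadE, monE, ArithExpr.eval_add, ArithExpr.eval_sub, ArithExpr.eval_mul, ArithExpr.eval_neg, ArithExpr.eval_const, ArithExpr.eval_var, Rat.cast_mul, Rat.cast_add, Rat.cast_sub, Rat.cast_neg, Rat.cast_div, Rat.cast_ofNat, Rat.cast_one, Rat.cast_zero]; ring
  · rw [a5]; simp only [faceE, linE, quadE, monE, ArithExpr.eval_add, ArithExpr.eval_sub, ArithExpr.eval_mul, ArithExpr.eval_neg, ArithExpr.eval_const, ArithExpr.eval_var, Rat.cast_mul, Rat.cast_add, Rat.cast_sub, Rat.cast_neg, Rat.cast_div, Rat.cast_ofNat, Rat.cast_one, Rat.cast_zero]; ring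
  · rw [a6]; simp only [faceE, linE, quadE, monE, ArithExpr.eval_add, ArithExpr.eval_sub, ArithExpr.eval_mul, ArithExpr.eval_neg, ArithExpr.eval_const, ArithExpr.eval_var, Rat.cast_mul, Rat.cast_add, Rat.cast_sub, Rat.cast_neg, Rat.cast_div, Rat.cast_ofNat, Rat.cast_one, Rat.cast_zero]; ring
  · rw [a7]; simp only [faceE, linE, quadE, monE, ArithExpr.eval_add, ArithExpr.eval_sub, ArithExpr.eval_mul, ArithExpr.eval_neg, ArithExpr.eval_const, ArithExpr.eval_var, Rat.cast_mul, Rat.cast_add, Rat.cast_sub, Rat.cast_neg, Rat.cast_div, Rat.cast_ofNat, Rat.cast_one, Rat.cast_zero]; ring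
  · rw [a8]; simp only [faceE, linE, quadE, monE, ArithExpr.eval_add, ArithExpr.eval_sub, ArithExpr.eval_mul, ArithExpr.eval_neg, ArithExpr.eval_const, ArithExpr.eval_var, Rat.cast_mul, Rat.cast_add, Rat.cast_sub, Rat.cast_neg, Rat.cast_div, Rat.cast_ofNat, Rat.cast_one, Rat.cast_zero]; ring
  · rw [a9]; simp only [faceE, linE, quadE, monE, ArithExpr.eval_add, ArithExpr.eval_sub, ArithExpr.eval_mul, ArithExpr.eval_neg, ArithExpr.eval_const, ArithExpr.eval_var, Rat.cast_mul, Rat.cast_add, Rat.cast_sub, Rat.cast_neg, Rat.cast_div, Rat.cast_ofNat, Rat.cast_one, Rat.cast_zero]; ring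
  · rw [a10]; simp only [faceE, linE, quadE, monE, ArithExpr.eval_add, ArithExpr.eval_sub, ArithExpr.eval_mul, ArithExpr.eval_neg, ArithExpr.eval_const, ArithExpr.eval_var, Rat.cast_mul, Rat.cast_add, Rat.cast_sub, Rat.cast_neg, Rat.cast_div, Rat.cast_ofNat, Rat.cast_one, Rat.cast_zero]; ring

/-- **The base slacks are non-negative when the three windows lie in `Ω`.** [folklore] -/
theorem gsBase_nonneg (hX : ∀ j, face θ j x ≤ 0) (hLo : ∀ j, face θ j (vec4 v (x 0) (x 1) (x 2)) ≤ 0)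
    (hUp : ∀ j, face θ j (vec4 (x 1) (x 2) (x 3) z) ≤ 0) : ∀ g ∈ gsBase θ, 0 ≤ g.eval (pt x v z L p b2) := by
  intro g hg
  simp only [gsBase, List.mem_append, List.mem_map] at hg
  have hx4 : vec4 (x 0) (x 1) (x 2) (x 3) = x := by funext i; fin_cases i <;> rfl
  rcases hg with (⟨j, -, rfl⟩ | ⟨j, -, rfl⟩) | ⟨j, -, rfl⟩
  · rw [ArithExpr.eval_neg, eval_faceE]
    have e : vec4 (pt x v z L p b2 (slotsX 0)) (pt x v z L p b2 (slotsX 1)) (pt x v z L p b2 (slotsX 2))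
        (pt x v z L p b2 (slotsX 3)) = x := hx4
    rw [e]; linarith [hX j]
  · rw [ArithExpr.eval_neg, eval_faceE]
    have e : vec4 (pt x v z L p b2 (slotsLo 0)) (pt x v z L p b2 (slotsLo 1)) (pt x v z L p b2 (slotsLo 2))
        (pt x v z L p b2 (slotsLo 3)) = vec4 v (x 0) (x 1) (x 2) := rfl
    rw [e]; linarith [hLo j]
  · rw [ArithExpr.eval_neg, eval_faceE]
    have e : vec4 (pt x v z L p b2 (slotsUp 0)) (pt x v z L p b2 (slotsUp 1)) (pt x v z L p b2 (slotsUp 2))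
        (pt x v z L p b2 (slotsUp 3)) = vec4 (x 1) (x 2) (x 3) z := rfl
    rw [e]; linarith [hUp j]

/-- The two EXTRA slacks `qElim k ≥ 0`, `49/50 − qElim k ≥ 0` hold on the active face. [folklore] -/
theorem extra_nonneg (ha0 : θ.a0 ≠ 0) (k : Ix) (hk : face θ k x = 0) (h0 : ∀ i, 0 ≤ x i) (hc : ∀ i, x i ≤ (49 / 50 : ℝ)) :
    ∀ g ∈ [qElim θ k, .sub (.const (49 / 50)) (qElim θ k)], 0 ≤ g.eval (pt x v z L p b2) := by
  have hq := pt_sElim_eq θ x v z L p b2 ha0 k hk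
  have hs : sElim k = 0 ∨ sElim k = 1 ∨ sElim k = 2 ∨ sElim k = 3 := by cases k <;> simp [sElim]
  have hlo : 0 ≤ pt x v z L p b2 (sElim k) := by rcases hs with h | h | h | h <;> rw [h] <;> simp [h0]
  have hhi : pt x v z L p b2 (sElim k) ≤ 49 / 50 := by rcases hs with h | h | h | h <;> rw [h] <;> simp [hc]
  intro g hg
  simp only [List.mem_cons, List.mem_nil_iff, or_false] at hg
  rcases hg with rfl | rfl
  · rw [← hq]; exact hlo
  · simp only [ArithExpr.eval_sub, ArithExpr.eval_const]; rw [← hq]; push_cast; linarith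

end evals

/-! ## The certificate bridge -/

/-- **Inertial face condition from a kernel certificate** (parametric family). [cite: FigueiredoStolfi2004, §3] -/
theorem inertial_of_cert {θ : Params} (ha0 : θ.a0 ≠ 0) {k : Ix} {t : KdCert LeafMul} {B : Box}
    (hcert : t.check (leafCheckAff (substVar (sElim k) (qElim θ k) (eBase θ k))
      ((gsBase θ).map (substVar (sElim k) (qElim θ k)) ++ [qElim θ k, .sub (.const (49 / 50)) (qElim θ k)]) (-(1 / 256))) B = true)
    {x : Fin 4 → ℝ} {v z L p b2 : ℝ} (hmem : Box.mem B (pt x v z L p b2))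
    (h0 : ∀ i, 0 ≤ x i) (hc : ∀ i, x i ≤ (49 / 50 : ℝ))
    (hX : ∀ j, face θ j x ≤ 0) (hLo : ∀ j, face θ j (vec4 v (x 0) (x 1) (x 2)) ≤ 0)
    (hUp : ∀ j, face θ j (vec4 (x 1) (x 2) (x 3) z) ≤ 0) (hk : face θ k x = 0) :
    faceGrad θ k 0 x * (v ^ 2 - p * x 0 * x 1) + faceGrad θ k 1 x * (L * (x 0 ^ 2 - p * x 1 * x 2)) +
      faceGrad θ k 2 x * (L ^ 2 * (x 1 ^ 2 - p * x 2 * x 3)) + faceGrad θ k 3 x * (L ^ 3 * (x 2 ^ 2 - p * x 3 * z)) < 0 := by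
  rw [← eval_eBase θ x v z L p b2 k]
  exact eval_lt_zero_of_kdCheckAff_subst (by norm_num) hcert _ hmem (pt_sElim_eq θ x v z L p b2 ha0 k hk)
    (gsBase_nonneg θ x v z L p b2 hX hLo hUp) (extra_nonneg θ x v z L p b2 ha0 k hk h0 hc)

/-- **Damping sign condition from a kernel certificate** (parametric family). [cite: FigueiredoStolfi2004, §3] -/
theorem damping_of_cert {θ : Params} (ha0 : θ.a0 ≠ 0) {k : Ix} {t : KdCert LeafMul} {B : Box}
    (hcert : t.check (leafCheckAff (.neg (substVar (sElim k) (qElim θ k) (dBase θ k)))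
      ((gsBase θ).map (substVar (sElim k) (qElim θ k)) ++ [qElim θ k, .sub (.const (49 / 50)) (qElim θ k)]) 0) B = true)
    {x : Fin 4 → ℝ} {v z L p b2 : ℝ} (hmem : Box.mem B (pt x v z L p b2))
    (h0 : ∀ i, 0 ≤ x i) (hc : ∀ i, x i ≤ (49 / 50 : ℝ))
    (hX : ∀ j, face θ j x ≤ 0) (hLo : ∀ j, face θ j (vec4 v (x 0) (x 1) (x 2)) ≤ 0)
    (hUp : ∀ j, face θ j (vec4 (x 1) (x 2) (x 3) z) ≤ 0) (hk : face θ k x = 0) :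
    0 ≤ faceGrad θ k 0 x * x 0 + faceGrad θ k 1 x * (b2 * x 1) + faceGrad θ k 2 x * (b2 ^ 2 * x 2) +
      faceGrad θ k 3 x * (b2 ^ 3 * x 3) := by
  rw [← eval_dBase θ x v z L p b2 k]
  exact eval_nonneg_of_kdCheckAff_subst hcert _ hmem (pt_sElim_eq θ x v z L p b2 ha0 k hk)
    (gsBase_nonneg θ x v z L p b2 hX hLo hUp) (extra_nonneg θ x v z L p b2 ha0 k hk h0 hc)

end Summit.NavierStokesRegularity.NavierStokesRegularity.Theorems.VirtualFloor.GapFamily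

end
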